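import Literature.Order.WellQuasiOrder.UpperSets
import Mathlib.Data.Fin.Tuple.Basic
import Mathlib.Data.Fintype.Sigma
import Mathlib.Data.Fintype.Sum
import HarnessLib

/-!
# Orthant (Stanley) decomposition of the complement of an upper set of `ℕⁿ`

Topic: `Literature/Order/WellQuasiOrder`. For an upper set `E ⊆ ℕⁿ` (the exponent set of a
monomial ideal) the complement `ℕⁿ ∖ E` (the exponents of the STANDARD monomials) is a finite
DISJOINT union of translated coordinate orthants
`a + ℕ^S = {x | x_i ≥ a_i (i ∈ S), x_i = a_i (i ∉ S)}` (`exists_orthantDecomposition`).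
This is the combinatorial content of a Stanley decomposition of `K[X]/I` for a monomial ideal
`I` (Stanley 1982; Riquier–Janet "cones"; Sturmfels–White 1991, Lemma 2.4: every monomial ideal
admits a Stanley decomposition, computed by slicing along one variable), proved by induction on
`n`: the slices `E_c = {b | (c, b) ∈ E}` increase with `c` and stabilise from some `c₀`
(ascending chain condition for monomial ideals, `Maclagan.wellFoundedLT_upperSet`), so
`ℕ^{n+1} ∖ E = ⊔_{c < c₀} {c} × (ℕⁿ ∖ E_c) ⊔ [c₀, ∞) × (ℕⁿ ∖ E_{c₀})`.
It is the input of the existence, with non-negative top form, of multigraded Hilbert polynomials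
(each orthant contributes a product of binomial coefficients).

No definitions: an orthant is given by its apex `a : Fin n → ℕ` and free directions
`S : Finset (Fin n)`, membership being spelled out as
`∀ i, (i ∈ S → a i ≤ x i) ∧ (i ∉ S → x i = a i)`.

## References

* R. P. Stanley, *Linear Diophantine equations and local cohomology*, Invent. Math. 68 (1982)
  175–193 (Stanley decompositions).
* B. Sturmfels, N. White, *Computing combinatorial decompositions of rings*, Combinatorica 11
  (1991) 275–293, Lemma 2.4.
* D. Maclagan, *Antichains of monomial ideals are finite*, Proc. AMS 129 (2001), Thm. 1.2 (the
  chain condition used). [Maclagan2001]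
-/

namespace Literature.Order.WellQuasiOrder

/-- **Orthant decomposition of the standard monomials** (Stanley decomposition of the complement
of an upper set of `ℕⁿ`; Sturmfels–White 1991, Lemma 2.4): for every upper set `E ⊆ ℕⁿ` there are
finitely many apexes `a_j ∈ ℕⁿ` and direction sets `S_j ⊆ {0, …, n-1}` such that a point lies
outside `E` iff it lies in some orthant `a_j + ℕ^{S_j}`, and it then lies in exactly one.
(The chain condition used is Maclagan 2001, Thm. 1.2, `Maclagan.wellFoundedLT_upperSet`.)
[folklore] -/
theorem exists_orthantDecomposition :
    ∀ (n : ℕ) (E : Set (Fin n → ℕ)), IsUpperSet E →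
      ∃ (κ : Type) (_ : Fintype κ) (a : κ → Fin n → ℕ) (S : κ → Finset (Fin n)),
        (∀ x : Fin n → ℕ, x ∉ E ↔
          ∃ j, ∀ i, (i ∈ S j → a j i ≤ x i) ∧ (i ∉ S j → x i = a j i)) ∧
        (∀ (x : Fin n → ℕ) (j j' : κ),
          (∀ i, (i ∈ S j → a j i ≤ x i) ∧ (i ∉ S j → x i = a j i)) →
          (∀ i, (i ∈ S j' → a j' i ≤ x i) ∧ (i ∉ S j' → x i = a j' i)) → j = j') := by
  intro n
  induction n with
  | zero =>
    intro E _
    by_cases h0 : (fun i : Fin 0 => i.elim0) ∈ E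
    · refine ⟨PEmpty, inferInstance, fun j => j.elim, fun j => j.elim, fun x => ?_, fun x j => j.elim⟩
      have hx : x = fun i : Fin 0 => i.elim0 := funext fun i => i.elim0
      simp only [IsEmpty.exists_iff, iff_false, not_not, hx]
      exact h0
    · refine ⟨PUnit, inferInstance, fun _ i => i.elim0, fun _ => ∅, fun x => ?_, fun x j j' _ _ => ?_⟩
      · have hx : x = fun i : Fin 0 => i.elim0 := funext fun i => i.elim0
        simp only [hx, h0, not_false_eq_true, true_iff]
        exact ⟨PUnit.unit, fun i => i.elim0⟩
      · rfl
  | succ n ih =>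
    intro E hE
    classical
    -- slices along the first coordinate: increasing upper sets, stable from `c₀`
    have hup : ∀ c : ℕ, IsUpperSet {b : Fin n → ℕ | (Fin.cons c b : Fin (n + 1) → ℕ) ∈ E} := by
      intro c b b' hbb' hb
      simp only [Set.mem_setOf_eq] at hb ⊢
      exact hE (Fin.cons_le_cons.mpr ⟨le_rfl, hbb'⟩) hb
    let Es : ℕ → UpperSet (Fin n → ℕ) := fun c =>
      ⟨{b : Fin n → ℕ | (Fin.cons c b : Fin (n + 1) → ℕ) ∈ E}, hup c⟩
    have hEs_mem : ∀ c b, b ∈ Es c ↔ (Fin.cons c b : Fin (n + 1) → ℕ) ∈ E := fun c b => Iff.rfl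
    have hanti : Antitone Es := by
      intro c c' hcc'
      rw [← UpperSet.coe_subset_coe]
      intro b hb
      rw [SetLike.mem_coe, hEs_mem] at hb ⊢
      exact hE (Fin.cons_le_cons.mpr ⟨hcc', le_rfl⟩) hb
    haveI := Maclagan.wellFoundedLT_upperSet (n := n)
    obtain ⟨c₀, hc₀⟩ := WellFoundedLT.antitone_chain_condition hanti
    have hstab : ∀ c, c₀ ≤ c → ∀ b, (Fin.cons c b : Fin (n + 1) → ℕ) ∈ E ↔
        (Fin.cons c₀ b : Fin (n + 1) → ℕ) ∈ E := by
      intro c hc b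
      rw [← hEs_mem, ← hEs_mem, hc₀ c hc]
    -- decompositions of the slices
    have hsl : ∀ c : ℕ, ∃ (κ : Type) (_ : Fintype κ) (a : κ → Fin n → ℕ) (S : κ → Finset (Fin n)),
        (∀ x : Fin n → ℕ, (Fin.cons c x : Fin (n + 1) → ℕ) ∉ E ↔
          ∃ j, ∀ i, (i ∈ S j → a j i ≤ x i) ∧ (i ∉ S j → x i = a j i)) ∧
        (∀ (x : Fin n → ℕ) (j j' : κ),
          (∀ i, (i ∈ S j → a j i ≤ x i) ∧ (i ∉ S j → x i = a j i)) →
          (∀ i, (i ∈ S j' → a j' i ≤ x i) ∧ (i ∉ S j' → x i = a j' i)) → j = j') :=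
      fun c => ih {b : Fin n → ℕ | (Fin.cons c b : Fin (n + 1) → ℕ) ∈ E} (hup c)
    choose κ instκ a S hmem huniq using hsl
    -- the pieces: `{c} × (a + ℕ^S)` for `c < c₀`, and `[c₀, ∞) × (a + ℕ^S)` for the stable slice
    let ι : Type := (Σ c : Fin c₀, κ c) ⊕ κ c₀
    haveI : ∀ c, Fintype (κ c) := instκ
    haveI : Fintype ι := inferInstance
    let A : ι → Fin (n + 1) → ℕ := fun p => match p with
      | Sum.inl ⟨c, j⟩ => Fin.cons (c : ℕ) (a c j)
      | Sum.inr j => Fin.cons c₀ (a c₀ j)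
    let T : ι → Finset (Fin (n + 1)) := fun p => match p with
      | Sum.inl ⟨c, j⟩ => (S c j).map (Fin.succEmb n)
      | Sum.inr j => insert 0 ((S c₀ j).map (Fin.succEmb n))
    -- membership in the new pieces, unfolded
    -- membership in the shifted direction sets
    have hmap0 : ∀ (U : Finset (Fin n)), (0 : Fin (n + 1)) ∉ U.map (Fin.succEmb n) := by
      intro U h
      obtain ⟨i, -, hi⟩ := Finset.mem_map.mp h
      exact Fin.succ_ne_zero i (by rw [← hi, Fin.coe_succEmb])
    have hmaps : ∀ (U : Finset (Fin n)) (i : Fin n), i.succ ∈ U.map (Fin.succEmb n) ↔ i ∈ U := by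
      intro U i
      rw [← Finset.mem_map' (Fin.succEmb n), Fin.coe_succEmb]
    have hmemA_inl : ∀ (x : Fin (n + 1) → ℕ) (c : Fin c₀) (j : κ c),
        (∀ i, (i ∈ T (Sum.inl ⟨c, j⟩) → A (Sum.inl ⟨c, j⟩) i ≤ x i) ∧
          (i ∉ T (Sum.inl ⟨c, j⟩) → x i = A (Sum.inl ⟨c, j⟩) i)) ↔
        x 0 = c ∧ ∀ i, (i ∈ S c j → a c j i ≤ Fin.tail x i) ∧
          (i ∉ S c j → Fin.tail x i = a c j i) := by
      intro x c j
      change (∀ i, (i ∈ (S c j).map (Fin.succEmb n) → (Fin.cons (c : ℕ) (a c j) : Fin (n + 1) → ℕ) i ≤ x i) ∧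
          (i ∉ (S c j).map (Fin.succEmb n) → x i = (Fin.cons (c : ℕ) (a c j) : Fin (n + 1) → ℕ) i)) ↔ _
      rw [Fin.forall_fin_succ]
      simp only [hmap0, hmaps, false_imp_iff, true_and, not_false_eq_true, forall_const,
        Fin.cons_zero, Fin.cons_succ]
      rfl
    have hmemA_inr : ∀ (x : Fin (n + 1) → ℕ) (j : κ c₀),
        (∀ i, (i ∈ T (Sum.inr j) → A (Sum.inr j) i ≤ x i) ∧
          (i ∉ T (Sum.inr j) → x i = A (Sum.inr j) i)) ↔
        c₀ ≤ x 0 ∧ ∀ i, (i ∈ S c₀ j → a c₀ j i ≤ Fin.tail x i) ∧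
          (i ∉ S c₀ j → Fin.tail x i = a c₀ j i) := by
      intro x j
      change (∀ i, (i ∈ insert 0 ((S c₀ j).map (Fin.succEmb n)) →
            (Fin.cons c₀ (a c₀ j) : Fin (n + 1) → ℕ) i ≤ x i) ∧
          (i ∉ insert 0 ((S c₀ j).map (Fin.succEmb n)) →
            x i = (Fin.cons c₀ (a c₀ j) : Fin (n + 1) → ℕ) i)) ↔ _
      rw [Fin.forall_fin_succ]
      simp only [Finset.mem_insert, hmap0, hmaps, true_or, forall_const, not_true_eq_false,
        false_imp_iff, and_true, Fin.cons_zero, Fin.cons_succ, Fin.succ_ne_zero, false_or]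
      rfl
    refine ⟨ι, inferInstance, A, T, fun x => ?_, fun x p p' hp hp' => ?_⟩
    · -- characterisation of the complement
      have hx : x = Fin.cons (x 0) (Fin.tail x) := (Fin.cons_self_tail x).symm
      constructor
      · intro hxE
        rcases Nat.lt_or_ge (x 0) c₀ with hlt | hge
        · have h1 : (Fin.cons (x 0) (Fin.tail x) : Fin (n + 1) → ℕ) ∉ E := by rwa [← hx]
          obtain ⟨j, hj⟩ := (hmem (x 0) (Fin.tail x)).mp h1
          refine ⟨Sum.inl ⟨⟨x 0, hlt⟩, j⟩, ?_⟩
          exact (hmemA_inl x ⟨x 0, hlt⟩ j).mpr ⟨rfl, hj⟩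
        · have h1 : (Fin.cons c₀ (Fin.tail x) : Fin (n + 1) → ℕ) ∉ E := by
            rw [← hstab (x 0) hge, ← hx]
            exact hxE
          obtain ⟨j, hj⟩ := (hmem c₀ (Fin.tail x)).mp h1
          exact ⟨Sum.inr j, (hmemA_inr x j).mpr ⟨hge, hj⟩⟩
      · rintro ⟨p, hp⟩
        rcases p with ⟨c, j⟩ | j
        · obtain ⟨h0, hj⟩ := (hmemA_inl x c j).mp hp
          have h1 := (hmem c (Fin.tail x)).mpr ⟨j, hj⟩
          rwa [← h0, ← hx] at h1
        · obtain ⟨h0, hj⟩ := (hmemA_inr x j).mp hp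
          have h1 := (hmem c₀ (Fin.tail x)).mpr ⟨j, hj⟩
          rwa [← hstab (x 0) h0, ← hx] at h1
    · -- uniqueness of the piece
      rcases p with ⟨c, j⟩ | j <;> rcases p' with ⟨c', j'⟩ | j'
      · obtain ⟨h0, hj⟩ := (hmemA_inl x c j).mp hp
        obtain ⟨h0', hj'⟩ := (hmemA_inl x c' j').mp hp'
        have hcc : c = c' := Fin.ext (by rw [← h0, ← h0'])
        subst hcc
        rw [huniq c (Fin.tail x) j j' hj hj']
      · obtain ⟨h0, -⟩ := (hmemA_inl x c j).mp hp
        obtain ⟨h0', -⟩ := (hmemA_inr x j').mp hp'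
        exact absurd c.isLt (by omega)
      · obtain ⟨h0, -⟩ := (hmemA_inr x j).mp hp
        obtain ⟨h0', -⟩ := (hmemA_inl x c' j').mp hp'
        exact absurd c'.isLt (by omega)
      · obtain ⟨-, hj⟩ := (hmemA_inr x j).mp hp
        obtain ⟨-, hj'⟩ := (hmemA_inr x j').mp hp'
        rw [huniq c₀ (Fin.tail x) j j' hj hj']

end Literature.Order.WellQuasiOrder
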